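import Literature.AlgebraicGeometry.Modules.PushforwardBaseChangeHom
import Literature.AlgebraicGeometry.Modules.CechBaseChangeHom
import HarnessLib

/-!
# The base-change morphism `b^* p_* G ⟶ p_{T*} pr^* G` is an isomorphism / a monomorphism when it is so on affine charts

[Hartshorne1977] III Prop. 9.3 (proof) / [StacksProject, Tag 02KG–02KH]: the base change map `u^* f_* ℱ ⟶ g_* v^* ℱ` is checked
on an affine open `V = Spec A ⊆ S` and an affine open `W = Spec A' ⊆ u⁻¹V` of the new base, where its source has sections
`A' ⊗_A Γ(f⁻¹V, ℱ)` and the question becomes whether `A' ⊗_A Γ(X_V, ℱ) ⟶ Γ(X_W, v^*ℱ)`, `a' ⊗ s ↦ a'·v^*(s)`, is bijective —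
«cohomology commutes with (flat / arbitrary) base change in degree `0`» ([Hartshorne1977] III 9.3 for `u` flat, III 12.11 /
[MumfordAV1970] §5 Cor. 3 under fibrewise vanishing).

For the module-level base-change morphism `β := pushforwardBaseChangeHom w G` of ★ `Modules/PushforwardBaseChangeHom` (any commutative
square `w : pr ≫ p = pT ≫ b`) THIS FILE proves that reduction:

* `pushforwardBaseChangeHom_app_smul_unitSectionLE` — `β_W(t · η_b(s)|_W) = t · η_{pr}(s)|_{pT⁻¹W}` (★ section formula + `Γ(T, W)`-linearity);
* **`isIso_pushforwardBaseChangeHom_of_charts`** — if `p_*G` is affine-localizing (e.g. `p` qcqs and `G` quasi-coherent) and for all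
  affine `V ⊆ S`, affine `W ⊆ b⁻¹V` there is SOME `Γ(T, W)`-linear isomorphism
  `Γ(T, W) ⊗_{Γ(S, V)} Γ(p_*G, V) ≃ Γ(pT_*(pr^*G), W)` with `t ⊗ s ↦ t · η_{pr}(s)|_{pT⁻¹W}` (the shape in which the cell's
  cohomology-and-base-change files ★ `Modules/ModuleSectionsFlatBaseChange` (flat `b`), ★ `Morphisms/SectionsBaseChangeOfFibreVanishing`
  (fibrewise `Ext¹`-vanishing) deliver it), then `β` is an ISOMORPHISM;
* **`mono_pushforwardBaseChangeHom_of_charts`** — if instead the `Γ(T, W)`-linear map `Γ(T, W) ⊗_{Γ(S, V)} Γ(p_*G, V) ⟶ Γ(pT_*(pr^*G), W)`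
  induced by `s ↦ η_{pr}(s)|` (the `IsBaseChange` lift of ★ `CechBaseChangeHom.isBaseChange_unitSectionLE`, composed with `β_W`) is
  injective on all such charts, `β` is a MONOMORPHISM — the (hbc) input of ★ `Morphisms/ContainmentRepOfPushforward`.

Proof: `Γ(W, b^*(p_*G))` IS the base change `Γ(T, W) ⊗_{Γ(S, V)} Γ(p_*G, V)` with structure map `s ↦ η_b(s)|_W`
(★ `isBaseChange_unitSectionLE`), `β_W` is `Γ(T, W)`-linear and sends `η_b(s)|_W ↦ η_{pr}(s)|_{pT⁻¹W}`
(★ `pushforwardBaseChangeHom_app_unitSectionLE`), and the affine `W` subordinate to affine `V` form a basis of `T`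
(★ `PullbackFlatMono.isBasis_affineOpens_le_preimage`; ★ `IsoOfSectionsOnBasis`).  Theorems only; no `sorry`, no instance, no named fact.
Cell hodgecm-mathlib, F-DAG second wave (h6-d) FILE D (the (hbc) adapter).  HC_CM is proved only modulo the printed citations until rung 0
closes; this file discharges none of them.

## References
* [Hartshorne1977] R. Hartshorne, *Algebraic Geometry* (1977), III Prop. 9.3 (and proof), III Thm. 12.11, II §5 p. 110.
* [StacksProject] The Stacks Project, Tag 02KG (affine base change), Tag 02KH (flat base change), Tag 02N6 (base change map).
* [MumfordAV1970] D. Mumford, *Abelian Varieties* (1970), §5 Cor. 3 (p. 53).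
-/

noncomputable section

-- `TopCat.Presheaf`/`Scheme.Modules` are not reducible (as in Mathlib's `AlgebraicGeometry/Modules/Sheaf.lean`).
set_option backward.isDefEq.respectTransparency false

open CategoryTheory CategoryTheory.Limits AlgebraicGeometry TopologicalSpace Opposite TensorProduct

universe u

namespace Literature.AlgebraicGeometry.Modules

section Charts

variable {X S T XT : Scheme.{u}} {pr : XT ⟶ X} {pT : XT ⟶ T} {p : X ⟶ S} {b : T ⟶ S} (w : pr ≫ p = pT ≫ b)
  (G : X.Modules)

/-- The two routes `Γ(S, V) ⟶ Γ(X_T, pT⁻¹W)` through the square agree: `pr♯ ∘ p♯ = pT♯ ∘ b♯` on sections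
(Mathlib `Scheme.Hom.appLE_comp_appLE`). [cite: Hartshorne1977, III Prop. 9.3 (proof)] -/
theorem appLE_appLE_eq_of_sq {V : S.Opens} {W : T.Opens} (i : W ≤ b ⁻¹ᵁ V) (r : Γ(S, V)) :
    pr.appLE (p ⁻¹ᵁ V) (pT ⁻¹ᵁ W) ((Scheme.Hom.preimage_mono pT i).trans (preimage_preimage_eq_of_sq w V).ge)
        (p.appLE V (p ⁻¹ᵁ V) le_rfl r) =
      pT.appLE W (pT ⁻¹ᵁ W) le_rfl (b.appLE V W i r) := by
  have h₁ := congrArg (fun φ : Γ(S, V) ⟶ Γ(XT, pT ⁻¹ᵁ W) => φ r)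
    (Scheme.Hom.appLE_comp_appLE pr p V (p ⁻¹ᵁ V) (pT ⁻¹ᵁ W) le_rfl
      ((Scheme.Hom.preimage_mono pT i).trans (preimage_preimage_eq_of_sq w V).ge))
  have h₂ := congrArg (fun φ : Γ(S, V) ⟶ Γ(XT, pT ⁻¹ᵁ W) => φ r)
    (Scheme.Hom.appLE_comp_appLE pT b V W (pT ⁻¹ᵁ W) i le_rfl)
  simp only [CommRingCat.comp_apply] at h₁ h₂
  rw [h₁, h₂]
  simp only [w]

/-- **`β_W` on the `Γ(T, W)`-span of the pulled-back sections**: `β_W(t · η_b(s)|_W) = t · η_{pr}(s)|_{pT⁻¹W}`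
(★ `pushforwardBaseChangeHom_app_unitSectionLE` and `Γ(T, W)`-linearity of `β_W`). [cite: Hartshorne1977, III Prop. 9.3 (proof)]
[cite: StacksProject, Tag 02N6] -/
theorem pushforwardBaseChangeHom_app_smul_unitSectionLE {V : S.Opens} {W : T.Opens} (i : W ≤ b ⁻¹ᵁ V)
    (t : Γ(T, W)) (s : Γ(G, p ⁻¹ᵁ V)) :
    (pushforwardBaseChangeHom w G).app W
        (t • unitSectionLE b ((Scheme.Modules.pushforward p).obj G) i
          (show Γ((Scheme.Modules.pushforward p).obj G, V) from s)) =
      t • (show Γ((Scheme.Modules.pushforward pT).obj ((Scheme.Modules.pullback pr).obj G), W) from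
        unitSectionLE pr G ((Scheme.Hom.preimage_mono pT i).trans (preimage_preimage_eq_of_sq w V).ge) s) := by
  rw [Scheme.Modules.Hom.app_smul, pushforwardBaseChangeHom_app_unitSectionLE]

/-- **The base-change morphism is an isomorphism when it is one on affine charts** ([Hartshorne1977] III 9.3 (proof),
[StacksProject, Tag 02KH]): if `p_*G` is affine-localizing and for all affine `V ⊆ S`, affine `W ⊆ b⁻¹V` there is a
`Γ(T, W)`-linear isomorphism `Γ(T, W) ⊗_{Γ(S, V)} Γ(p_*G, V) ≃ Γ(pT_*(pr^*G), W)` with `t ⊗ s ↦ t · η_{pr}(s)|_{pT⁻¹W}`, then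
`pushforwardBaseChangeHom w G` is an isomorphism.  (`Γ(T, W)` is a `Γ(S, V)`-algebra through `b♯`; the statement binds that
structure with `letI`, as ★ `CechBaseChangeHom.isBaseChange_unitSectionLE` does.) [cite: Hartshorne1977, III Prop. 9.3 (proof)]
[cite: StacksProject, Tag 02KH] [cite: MumfordAV1970, §5 Cor. 3 (p. 53)] -/
theorem isIso_pushforwardBaseChangeHom_of_charts
    (hN : IsAffineLocalizing ((Scheme.Modules.pushforward p).obj G))
    (h : ∀ (V : S.Opens) (_ : IsAffineOpen V) (W : T.Opens) (_ : IsAffineOpen W) (i : W ≤ b ⁻¹ᵁ V),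
      letI := (b.appLE V W i).hom.toAlgebra
      ∃ e : Γ(T, W) ⊗[Γ(S, V)] Γ((Scheme.Modules.pushforward p).obj G, V) ≃ₗ[Γ(T, W)]
          Γ((Scheme.Modules.pushforward pT).obj ((Scheme.Modules.pullback pr).obj G), W),
        ∀ (t : Γ(T, W)) (s : Γ(G, p ⁻¹ᵁ V)),
          e (t ⊗ₜ (show Γ((Scheme.Modules.pushforward p).obj G, V) from s)) =
            t • (show Γ((Scheme.Modules.pushforward pT).obj ((Scheme.Modules.pullback pr).obj G), W) from
              unitSectionLE pr G ((Scheme.Hom.preimage_mono pT i).trans (preimage_preimage_eq_of_sq w V).ge) s)) :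
    IsIso (pushforwardBaseChangeHom w G) := by
  refine isIso_of_bijective_on_basis _ (isBasis_affineOpens_le_preimage b) fun W hW' => ?_
  obtain ⟨hW, V, hV, i⟩ := hW'
  letI := (b.appLE V W i).hom.toAlgebra
  letI : Module Γ(S, V) Γ((Scheme.Modules.pullback b).obj ((Scheme.Modules.pushforward p).obj G), W) :=
    Module.compHom _ (b.appLE V W i).hom
  haveI : IsScalarTower Γ(S, V) Γ(T, W)
      Γ((Scheme.Modules.pullback b).obj ((Scheme.Modules.pushforward p).obj G), W) :=
    ⟨fun a c x => mul_smul ((b.appLE V W i).hom a) c x⟩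
  letI : Module Γ(S, V) Γ((Scheme.Modules.pushforward pT).obj ((Scheme.Modules.pullback pr).obj G), W) :=
    Module.compHom _ (b.appLE V W i).hom
  haveI : IsScalarTower Γ(S, V) Γ(T, W)
      Γ((Scheme.Modules.pushforward pT).obj ((Scheme.Modules.pullback pr).obj G), W) :=
    ⟨fun a c x => mul_smul ((b.appLE V W i).hom a) c x⟩
  have hbc := isBaseChange_unitSectionLE (f := b) (M := (Scheme.Modules.pushforward p).obj G) (i := i) hV hW hN
  obtain ⟨e, he⟩ := h V hV W hW i
  -- `β_W` as a `Γ(T, W)`-linear map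
  let βl : Γ((Scheme.Modules.pullback b).obj ((Scheme.Modules.pushforward p).obj G), W) →ₗ[Γ(T, W)]
      Γ((Scheme.Modules.pushforward pT).obj ((Scheme.Modules.pullback pr).obj G), W) :=
    { toFun := (pushforwardBaseChangeHom w G).app W
      map_add' := fun x y => map_add _ x y
      map_smul' := fun t x => Scheme.Modules.Hom.app_smul _ t x }
  -- `β_W ∘ (Γ(W) ⊗ Γ(p_*G, V) ≃ Γ(W, b^* p_* G)) = e`
  have key : βl ∘ₗ hbc.equiv.toLinearMap = e.toLinearMap := by
    apply TensorProduct.AlgebraTensorModule.ext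
    intro t s
    change βl (hbc.equiv (t ⊗ₜ s)) = e (t ⊗ₜ s)
    rw [IsBaseChange.equiv_tmul, he t s]
    exact pushforwardBaseChangeHom_app_smul_unitSectionLE w G i t s
  have hβ : Function.Bijective βl := by
    have h2 : (βl : _ → _) = e ∘ hbc.equiv.symm := by
      funext x
      have hx := congrArg (fun f => f (hbc.equiv.symm x)) key
      simpa using hx
    rw [h2]
    exact e.bijective.comp hbc.equiv.symm.bijective
  exact hβ

/-- `β` is a monomorphism as soon as `β_W` is injective for the affine `W ⊆ T` lying over affine opens of `S` (a basis of `T`,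
★ `PullbackFlatMono.isBasis_affineOpens_le_preimage`). [cite: StacksProject, Tag 02KG] -/
theorem mono_pushforwardBaseChangeHom_of_app_injective
    (h : ∀ (V : S.Opens) (_ : IsAffineOpen V) (W : T.Opens) (_ : IsAffineOpen W) (_ : W ≤ b ⁻¹ᵁ V),
      Function.Injective ((pushforwardBaseChangeHom w G).app W)) :
    Mono (pushforwardBaseChangeHom w G) :=
  mono_of_injective_on_basis _ (isBasis_affineOpens_le_preimage b) fun W hW' => by
    obtain ⟨hW, V, hV, i⟩ := hW'
    exact h V hV W hW i

/-- **The base-change morphism is a monomorphism when the chart maps are injective** ([StacksProject, Tag 02KG]): if `p_*G` is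
affine-localizing and for all affine `V ⊆ S`, affine `W ⊆ b⁻¹V` there is an INJECTIVE `Γ(T, W)`-linear map
`Γ(T, W) ⊗_{Γ(S, V)} Γ(p_*G, V) ⟶ Γ(pT_*(pr^*G), W)` with `t ⊗ s ↦ t · η_{pr}(s)|_{pT⁻¹W}`, then `pushforwardBaseChangeHom w G` is a
monomorphism — the (hbc) input of ★ `Morphisms/ContainmentRepOfPushforward` (only injectivity of «`H⁰` base change» is needed there).
[cite: Hartshorne1977, III Prop. 9.3 (proof)] [cite: StacksProject, Tag 02KG] -/
theorem mono_pushforwardBaseChangeHom_of_charts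
    (hN : IsAffineLocalizing ((Scheme.Modules.pushforward p).obj G))
    (h : ∀ (V : S.Opens) (_ : IsAffineOpen V) (W : T.Opens) (_ : IsAffineOpen W) (i : W ≤ b ⁻¹ᵁ V),
      letI := (b.appLE V W i).hom.toAlgebra
      ∃ e : Γ(T, W) ⊗[Γ(S, V)] Γ((Scheme.Modules.pushforward p).obj G, V) →ₗ[Γ(T, W)]
          Γ((Scheme.Modules.pushforward pT).obj ((Scheme.Modules.pullback pr).obj G), W),
        Function.Injective e ∧ ∀ (t : Γ(T, W)) (s : Γ(G, p ⁻¹ᵁ V)),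
          e (t ⊗ₜ (show Γ((Scheme.Modules.pushforward p).obj G, V) from s)) =
            t • (show Γ((Scheme.Modules.pushforward pT).obj ((Scheme.Modules.pullback pr).obj G), W) from
              unitSectionLE pr G ((Scheme.Hom.preimage_mono pT i).trans (preimage_preimage_eq_of_sq w V).ge) s)) :
    Mono (pushforwardBaseChangeHom w G) := by
  refine mono_pushforwardBaseChangeHom_of_app_injective w G fun V hV W hW i => ?_
  letI := (b.appLE V W i).hom.toAlgebra
  letI : Module Γ(S, V) Γ((Scheme.Modules.pullback b).obj ((Scheme.Modules.pushforward p).obj G), W) :=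
    Module.compHom _ (b.appLE V W i).hom
  haveI : IsScalarTower Γ(S, V) Γ(T, W)
      Γ((Scheme.Modules.pullback b).obj ((Scheme.Modules.pushforward p).obj G), W) :=
    ⟨fun a c x => mul_smul ((b.appLE V W i).hom a) c x⟩
  letI : Module Γ(S, V) Γ((Scheme.Modules.pushforward pT).obj ((Scheme.Modules.pullback pr).obj G), W) :=
    Module.compHom _ (b.appLE V W i).hom
  haveI : IsScalarTower Γ(S, V) Γ(T, W)
      Γ((Scheme.Modules.pushforward pT).obj ((Scheme.Modules.pullback pr).obj G), W) :=
    ⟨fun a c x => mul_smul ((b.appLE V W i).hom a) c x⟩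
  have hbc := isBaseChange_unitSectionLE (f := b) (M := (Scheme.Modules.pushforward p).obj G) (i := i) hV hW hN
  obtain ⟨e, he_inj, he⟩ := h V hV W hW i
  let βl : Γ((Scheme.Modules.pullback b).obj ((Scheme.Modules.pushforward p).obj G), W) →ₗ[Γ(T, W)]
      Γ((Scheme.Modules.pushforward pT).obj ((Scheme.Modules.pullback pr).obj G), W) :=
    { toFun := (pushforwardBaseChangeHom w G).app W
      map_add' := fun x y => map_add _ x y
      map_smul' := fun t x => Scheme.Modules.Hom.app_smul _ t x }
  have key : βl ∘ₗ hbc.equiv.toLinearMap = e := by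
    apply TensorProduct.AlgebraTensorModule.ext
    intro t s
    change βl (hbc.equiv (t ⊗ₜ s)) = e (t ⊗ₜ s)
    rw [IsBaseChange.equiv_tmul, he t s]
    exact pushforwardBaseChangeHom_app_smul_unitSectionLE w G i t s
  have h2 : (βl : _ → _) = e ∘ hbc.equiv.symm := by
    funext x
    have hx := congrArg (fun f => f (hbc.equiv.symm x)) key
    simpa using hx
  change Function.Injective βl
  rw [h2]
  exact he_inj.comp hbc.equiv.symm.injective

end Charts

end Literature.AlgebraicGeometry.Modules

end
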